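import Mathlib
import Summits.ValiantsHypothesis.ValiantsHypothesis.Theorems.GeneratorObstructionsPowGenDegreeQPWideAtomsAll

/-!
# Route GeneratorObstructions — crux K2 `PowGenDegreeQP` (stmt-ValiantsHypothesis-11655), line
# `trace-side-regimes`: K2 bounds the nullcone-separation degree of EVERY power trace in the window

Helper file (`--supports stmt-ValiantsHypothesis-11655`).  For a form `f ∈ Sym^m ℂ^N` with closed
`SL_N`-orbit the LEAST `k₀ > 0` such that the constant weight `-k₀·𝟙` occurs in `ℂ[Δ_m f]` exists,
and `k₀ N / m` is the least degree of an `SL_N`-invariant of `Sym^m ℂ^N` not vanishing at `f`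
(BI 2017 §3.3; tree `MinimalDegree` for `per`).  For the power traces of the window this least
constant weight is a GENERATOR TYPE (companion files: `exists_const_genType_self` at `n = m`,
`exists_wide_genType` at `n > m`), so the route's K2 bounds it:

* `exists_least_const_genType` — for `2 ≤ m`, any `e` (the cell `(m, e)` of the window; `tr X_m^m`
  by the MS2001 §4.1 Remark when `e = 0`, `tr X_{m+e}^m` by its general-exponent version when
  `e ≥ 1`): the least occurring constant weight `-k₀·𝟙` of `ℂ[Δ_m[tr X_{m+e}^m]]` exists, is a
  generator type, and `m ≤ k₀`;
* `powGenDegreeQP_bounds_nullcone_degree` — **K2 ⇒** for every `c` some `c₀` with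
  `k₀(m,e) · (m+e)² ≤ m · 2^((log₂ m + c₀)^c₀)` for all `2 ≤ m`, `m + e ≤ 2^((log₂ m + c)^c)`:
  quasi-polynomial nullcone-separation degree `e(tr X_n^m) = k₀ n²/m` for ALL `m ≤ n` in the window;
* `sliceGen_bounds_nullcone_degree_self` — the registered `stub_sliceGen` alone already gives the
  square case `n = m` (`k₀(m,0) · m ≤ 2^((log₂ m + c₀)^c₀)`), and `stub_wideGen` the cases `n > m`
  (`wideGen_bounds_nullcone_degree`, companion file).

Honest framing: implications from OPEN statements to concrete (open) degree bounds; nothing is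
proved about `e(tr X_n^m)` beyond `e ≥ n²`; `stub_sliceGen`, `stub_wideGen`, K2 remain OPEN;
`VP ≠ VNP` untouched.
-/

namespace Summit.ValiantsHypothesis.ValiantsHypothesis.Theorems.GeneratorObstructions.PowGenDegreeQP

open MvPolynomial
open Literature.NumberTheory.DiophantineGeometry Literature.Computability.AlgebraicComplexity
open Summit.ValiantsHypothesis.ValiantsHypothesis.Theses.GeneratorObstructions
open Summit.ValiantsHypothesis.ValiantsHypothesis.Theorems.GenInheritance
open Summit.ValiantsHypothesis.ValiantsHypothesis.Theorems.GeneratorObstructions.SliceTransfer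
open Summit.ValiantsHypothesis.ValiantsHypothesis.Theorems.GeneratorObstructions.PerGenDegreeSuperQP

-- `Summit.ValiantsHypothesis.ValiantsHypothesis.…` is the tree's mandated single-conjunct layout.
set_option linter.dupNamespace false

noncomputable section

/-- **The least occurring constant weight of `ℂ[Δ_m[tr X_{m+e}^m]]` is a generator type** (every
cell `(m, e)`, `m ≥ 2`): there is `k₀ ≥ m` with `-k₀·𝟙` occurring, no smaller positive constant
weight occurring, and `γ_{-k₀·𝟙} ≠ 0`.  Occurrence: polystability of `tr X_m^m` (`e = 0`, MS2001
§4.1 Remark) resp. of `tr X_{m+e}^m` (`e ≥ 1`, general-exponent version); atom and generator type by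
`exists_least_const_atom`, `finrank_quotient_ne_zero_of_atom`. [cite: BurgisserIkenmeyer2017, §3.3] -/
theorem exists_least_const_genType {m : ℕ} (hm : 2 ≤ m) (e : ℕ) :
    ∃ k₀ : ℕ, m ≤ k₀ ∧
      highestWeightSpace (orbitCoordRep (powFormLex ℂ (m + e) m) m) (fun _ => -(k₀ : ℤ)) ≠ ⊥ ∧
      (∀ k : ℕ, 0 < k → k < k₀ →
        highestWeightSpace (orbitCoordRep (powFormLex ℂ (m + e) m) m) (fun _ => -(k : ℤ)) = ⊥) ∧
      Module.finrank ℂ (↥(highestWeightSpace (orbitCoordRep (powFormLex ℂ (m + e) m) m) (fun _ => -(k₀ : ℤ))) ⧸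
        Submodule.comap (highestWeightSpace (orbitCoordRep (powFormLex ℂ (m + e) m) m) (fun _ => -(k₀ : ℤ))).subtype
          (⨆ p : Weight (MatIdx (m + e)) × Weight (MatIdx (m + e)),
            ⨆ (_ : p.1 + p.2 = (fun _ => -(k₀ : ℤ)) ∧ p.1 ≠ 0 ∧ p.2 ≠ 0),
            highestWeightSpace (orbitCoordRep (powFormLex ℂ (m + e) m) m) p.1 *
              highestWeightSpace (orbitCoordRep (powFormLex ℂ (m + e) m) m) p.2)) ≠ 0 := by
  have hex : ∃ k : ℕ, 0 < k ∧
      highestWeightSpace (orbitCoordRep (powFormLex ℂ (m + e) m) m) (fun _ => -(k : ℤ)) ≠ ⊥ := by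
    rcases Nat.eq_zero_or_pos e with he | he
    · subst he
      exact powFormLex_self_exists_hasHighestWeight_const hm
    · exact powFormLex_exists_hasHighestWeight_const (n := m + e) (by omega) hm (by nlinarith)
  obtain ⟨k₀, hk₀pos, hocc, hmin, hatom⟩ := exists_least_const_atom (powFormLex ℂ (m + e) m) m hex
  exact ⟨k₀, le_of_hasHighestWeight_const (m := m) (e := e) (by omega) hk₀pos hocc, hocc, hmin,
    finrank_quotient_ne_zero_of_atom _ (by omega) hocc hatom⟩

/-- **K2 ⇒ quasi-polynomial nullcone-separation degree of every power trace in the window.**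
`PowGenDegreeQP` implies: for every `c` there is `c₀` such that for all `2 ≤ m`,
`m + e ≤ 2^((log₂ m + c)^c)`, the least `k₀` with `-k₀·𝟙` occurring in `ℂ[Δ_m[tr X_{m+e}^m]]`
(`k₀ (m+e)²/m` = least degree of an `SL_{(m+e)²}`-invariant not vanishing at `tr X_{m+e}^m`)
satisfies `k₀ (m+e)² ≤ m · 2^((log₂ m + c₀)^c₀)`. [cite: BurgisserIkenmeyer2017, §3.3] -/
theorem powGenDegreeQP_bounds_nullcone_degree (hK2 : PowGenDegreeQP) :
    ∀ c : ℕ, ∃ c₀ : ℕ, ∀ m e : ℕ, 2 ≤ m → m + e ≤ 2 ^ ((Nat.log 2 m + c) ^ c) →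
      ∃ k₀ : ℕ, m ≤ k₀ ∧
        highestWeightSpace (orbitCoordRep (powFormLex ℂ (m + e) m) m) (fun _ => -(k₀ : ℤ)) ≠ ⊥ ∧
        (∀ k : ℕ, 0 < k → k < k₀ →
          highestWeightSpace (orbitCoordRep (powFormLex ℂ (m + e) m) m) (fun _ => -(k : ℤ)) = ⊥) ∧
        (k₀ : ℤ) * (((m + e) * (m + e) : ℕ) : ℤ) ≤ (m : ℤ) * 2 ^ ((Nat.log 2 m + c₀) ^ c₀) := by
  intro c
  obtain ⟨c₀, hc₀⟩ := hK2 c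
  refine ⟨c₀, fun m e hm hwin => ?_⟩
  obtain ⟨k₀, hk₀, hocc, hmin, hγ⟩ := exists_least_const_genType hm e
  refine ⟨k₀, hk₀, hocc, hmin, ?_⟩
  have hb := hc₀ m e (by omega) hwin _ hγ
  rw [size_const_neg, Fintype.card_lex, Fintype.card_prod, Fintype.card_fin, neg_neg] at hb
  push_cast at hb ⊢
  linarith

/-- **`stub_sliceGen` ⇒ the square case** (`n = m`): with the registered `stub_sliceGen` as
hypothesis (verbatim), for every `c` there is `c₀` such that for all `2 ≤ m ≤ 2^((log₂ m + c)^c)`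
the least `k₀` with `-k₀·𝟙_{m²}` occurring in `ℂ[Δ_m[tr X_m^m]]` — `e(tr X_m^m) = k₀ m` — satisfies
`k₀ · m ≤ 2^((log₂ m + c₀)^c₀)`: the slice generator type `ext_ι(-k₀·𝟙)` at the cell `(m, 0)`.
[cite: BurgisserIkenmeyer2017, §3.3] -/
theorem sliceGen_bounds_nullcone_degree_self
    (hS : ∀ c : ℕ, ∃ c₀ : ℕ, ∀ m e : ℕ, 1 ≤ m → m + e ≤ 2 ^ ((Nat.log 2 m + c) ^ c) →
      ∀ ι : MatIdx m → MatIdx (m + e), StrictMono ι → IsUpperSet (Set.range ι) →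
        ∀ χ : Weight (MatIdx m),
          Module.finrank ℂ (↥(highestWeightSpace (orbitCoordRep (powFormLex ℂ (m + e) m) m) (Function.extend ι χ 0)) ⧸ Submodule.comap (highestWeightSpace (orbitCoordRep (powFormLex ℂ (m + e) m) m) (Function.extend ι χ 0)).subtype (⨆ p : Weight (MatIdx (m + e)) × Weight (MatIdx (m + e)), ⨆ (_ : p.1 + p.2 = (Function.extend ι χ 0) ∧ p.1 ≠ 0 ∧ p.2 ≠ 0), highestWeightSpace (orbitCoordRep (powFormLex ℂ (m + e) m) m) p.1 * highestWeightSpace (orbitCoordRep (powFormLex ℂ (m + e) m) m) p.2)) ≠ 0 →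
            -(Weight.size χ) ≤ (m : ℤ) * 2 ^ ((Nat.log 2 m + c₀) ^ c₀)) :
    ∀ c : ℕ, ∃ c₀ : ℕ, ∀ m : ℕ, 2 ≤ m → m ≤ 2 ^ ((Nat.log 2 m + c) ^ c) →
      ∃ k₀ : ℕ, m ≤ k₀ ∧
        highestWeightSpace (orbitCoordRep (powFormLex ℂ m m) m) (fun _ => -(k₀ : ℤ)) ≠ ⊥ ∧
        (∀ k : ℕ, 0 < k → k < k₀ →
          highestWeightSpace (orbitCoordRep (powFormLex ℂ m m) m) (fun _ => -(k : ℤ)) = ⊥) ∧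
        (k₀ : ℤ) * (m : ℤ) ≤ 2 ^ ((Nat.log 2 m + c₀) ^ c₀) := by
  intro c
  obtain ⟨c₀, hc₀⟩ := hS c
  refine ⟨c₀, fun m hm hwin => ?_⟩
  obtain ⟨k₀, hk₀pos, hocc, hmin, hatom⟩ :=
    exists_least_const_atom (powFormLex ℂ m m) m (powFormLex_self_exists_hasHighestWeight_const hm)
  have hγ := finrank_quotient_ne_zero_of_atom _ (by omega) hocc hatom
  have hk₀ : m ≤ k₀ := le_of_hasHighestWeight_const (m := m) (e := 0) (by omega) hk₀pos hocc
  refine ⟨k₀, hk₀, hocc, hmin, ?_⟩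
  obtain ⟨ι, hι, hup⟩ := exists_finalSegment (n := m) (n' := m + 0) (Nat.le_add_right m 0)
  -- transfer the generator type of `A(Δ_m[tr X_m^m])` to the slice of the cell `(m, 0)`
  have hγ' := finrank_ne_zero_extend_of_rename_mem_orbitClosure hι hup
    (powFormLex_isHomogeneous ℂ m m) (powFormLex_ne_zero (by omega) m) (by omega)
    (rename_powFormLex_mem_orbitClosure (by omega) (Nat.le_add_right m 0) ι) _ hγ
  have hb := hc₀ m 0 (by omega) (by simpa using hwin) ι hι hup _ hγ'
  rw [size_const_neg, Fintype.card_lex, Fintype.card_prod, Fintype.card_fin, neg_neg] at hb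
  push_cast at hb
  have hm0 : (0 : ℤ) < m := by exact_mod_cast (show 0 < m by omega)
  have : (k₀ : ℤ) * m * m ≤ 2 ^ ((Nat.log 2 m + c₀) ^ c₀) * m := by linarith
  exact le_of_mul_le_mul_right this hm0

end

end Summit.ValiantsHypothesis.ValiantsHypothesis.Theorems.GeneratorObstructions.PowGenDegreeQP
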